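import Literature.NumberTheory.Automorphic.IdeleClassIntegration
import Literature.NumberTheory.Automorphic.PairLFunctionPolesGLOneTateProofs
import HarnessLib

/-!
# Tate's Lemma B on a fundamental domain: norm-layer integrals against a Hecke character
# non-trivial on the norm-one ideles vanish

Topic `NumberTheory/Automorphic`; namespace `Literature.NumberTheory.Automorphic`. Proof file
(theorems only; no definition, no named fact, no instance), the twisted companion of the "Tate
formulas" of `IdeleClassIntegration` (`∫_{𝓕 ∩ {|x| ≤ 1}} |x|^{s} dν = V/s`): the boundary terms of
Tate's decomposition of a zeta integral or of the mirabolic Eisenstein series **twisted by a Hecke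
character `η`** (`MirabolicEisensteinSeriesTwisted`; Cogdell, *Analytic theory of `L`-functions for
`GL_n`*, §2.3, p. 210: "`δ(s) = 0` … unless `η` is of the form `|·|^{inσ}`") are the integrals
`Φ(0) ∫_{𝓕 ∩ {|x| ≤ 1}} |x|^{ns} η(x) dν(x)` and `Φ̂(0) ∫_{𝓕 ∩ {|x| ≤ 1}} |x|^{n(s-1)} η(x) dν(x)`,
and they **vanish** as soon as `η` is non-trivial on the norm-one ideles `𝕀_K¹` — J. Tate, *Fourier
analysis in number fields and Hecke's zeta-functions*, in Cassels–Fröhlich (1967), Ch. XV, proof of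
Thm. 4.4.1, Lemma B: "`∫_E c(t𝔟) d𝔟 = 0` if `c(𝔞)` is non trivial on `J`". Here, as in
`IdeleClassIntegration`, "integration modulo `kˣ`" is integration over a measurable fundamental domain
`𝓕 ⊆ 𝕀_K` of `Kˣ`, for an arbitrary left-invariant measure `ν`, and Lemma B is proved by a swap of
fundamental domains instead of Tate's parametrisation `𝕀_K = ℝ_{>0} × J`:

* `setIntegral_mul_heckeCharacter_eq_zero_of_norm_one` (**main, abstract form**) — for a measurable
  `S ⊆ 𝕀_K` stable under multiplication by norm-one ideles, a weight `f` invariant under norm-one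
  ideles (e.g. any function of `|x|`) and a Hecke character `η` with `η(b) ≠ 1` for some `b ∈ 𝕀_K¹`,
  `∫_{S ∩ 𝓕} f(x) η(x) dν(x) = 0`. Proof: `F = 𝟙_S f η` is `Kˣ`-invariant (`η` is trivial on `Kˣ`,
  principal ideles have norm one), so its integrals over the two fundamental domains `𝓕` and `b 𝓕`
  agree (Mathlib `IsFundamentalDomain.setIntegral_eq`); by left invariance of `ν` the second is
  `∫_𝓕 F(b x) = η(b) ∫_𝓕 F`; hence `(1 - η(b)) ∫_𝓕 F = 0`;
* `HeckeCharacter.exists_ideleNorm_eq_one_and_ne_one` — the hypothesis holds for every `η` which is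
  not a norm twist (`exists_ideleNorm_eq_one_and_ne_one_of_not_isNormTwist`, Tate §4.3), in particular
  for every `η ≠ 1` trivial on `A_G = ℝ_{>0}` (`…_of_map_posRealIdele`, the characters of the tree's
  `L²(GL_1(K) A_G \ GL_1(𝔸_K))`);
* **the twisted Tate formulas** `setIntegral_ideleNorm_cpow_mul_heckeCharacter_eq_zero_of_le_one`
  (`∫_{𝓕 ∩ {|x| ≤ 1}} |x|^{s} η(x) dν = 0`), `…_of_one_le` (`∫_{𝓕 ∩ {|x| ≥ 1}} |x|^{s} η(x) dν = 0`)
  and `setIntegral_ideleNorm_cpow_mul_heckeCharacter_eq_zero` (over all of `𝓕`), for **every**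
  `s ∈ ℂ` (as Bochner integrals; where the untwisted integral converges, e.g. `re s > 0` below the
  unit norm, this is the genuine value `0`, the twisted integrand having the same absolute value).

## References

* J. Tate, *Fourier analysis in number fields and Hecke's zeta-functions* (1950), §4.4, proof of
  the Main Theorem 4.4.1, Lemma B, in J. W. S. Cassels, A. Fröhlich (eds.), *Algebraic Number Theory*
  (1967), Ch. XV (PDF p. 367 of the held copy) [CasselsFrohlichANT1967].
* J. W. Cogdell, *Analytic theory of L-functions for GL_n*, in J. Bernstein, S. Gelbart (eds.),
  *An Introduction to the Langlands Program* (2004), §2.3, p. 210 [CogdellAnalyticTheory2004].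
-/

noncomputable section

open scoped NNReal Pointwise
open NumberField IsDedekindDomain MeasureTheory Measure Set
open Literature.NumberTheory.GaloisRepresentations (HeckeCharacter ideleGroup principalIdeles)

namespace Literature.NumberTheory.Automorphic

variable (K : Type) [Field K] [NumberField K]

/-! ### The hypothesis: a norm-one idele where `η ≠ 1` -/

variable {K} in
/-- A Hecke character which is not a norm twist is `≠ 1` at some idele of norm one (Tate (1950),
§4.3: the quasi-characters trivial on `J = 𝕀_K¹` are exactly the `|·|^s`;
`exists_ideleNorm_eq_one_and_ne_one_of_not_isNormTwist`, stated here for the `ℝ≥0`-valued idele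
norm of `IdeleClassGroup`). [cite: CasselsFrohlichANT1967, Ch. XV §4.3] -/
theorem _root_.Literature.NumberTheory.GaloisRepresentations.HeckeCharacter.exists_ideleNorm_eq_one_and_ne_one
    {η : HeckeCharacter K} (h : ¬ η.IsNormTwist) :
    ∃ b : ideleGroup K, IdeleClassGroup.ideleNorm K b = 1 ∧ η b ≠ 1 := by
  obtain ⟨x, hx, hne⟩ := HeckeCharacter.exists_ideleNorm_eq_one_and_ne_one_of_not_isNormTwist h
  refine ⟨x, NNReal.coe_injective ?_, hne⟩
  rw [coe_ideleNorm, hx, NNReal.coe_one]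

variable {K} in
/-- A Hecke character `η ≠ 1` trivial on `A_G = ℝ_{>0}` (`posRealIdele`) is `≠ 1` at some idele of
norm one (it is not a norm twist, `HeckeCharacter.not_isNormTwist_of_map_posRealIdele`). [folklore] -/
theorem _root_.Literature.NumberTheory.GaloisRepresentations.HeckeCharacter.exists_ideleNorm_eq_one_and_ne_one_of_map_posRealIdele
    {η : HeckeCharacter K} (hA : ∀ t : ℝ≥0ˣ, η (posRealIdele K t) = 1) (h1 : η ≠ 1) :
    ∃ b : ideleGroup K, IdeleClassGroup.ideleNorm K b = 1 ∧ η b ≠ 1 :=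
  HeckeCharacter.exists_ideleNorm_eq_one_and_ne_one (HeckeCharacter.not_isNormTwist_of_map_posRealIdele hA h1)

/-! ### Norm layers and norm-one ideles -/

variable {K}

/-- The norm layers `{|x| ≤ 1}`, `{1 ≤ |x|}` (indeed every set defined by `|x|`) are stable under
multiplication by norm-one ideles. [folklore] -/
theorem mul_mem_setOf_ideleNorm_iff {b : ideleGroup K} (hb : IdeleClassGroup.ideleNorm K b = 1)
    (P : ℝ → Prop) (x : ideleGroup K) :
    b * x ∈ {x : ideleGroup K | P (IdeleClassGroup.ideleNorm K x : ℝ)} ↔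
      x ∈ {x : ideleGroup K | P (IdeleClassGroup.ideleNorm K x : ℝ)} := by
  simp only [Set.mem_setOf_eq, map_mul, hb, one_mul]

/-- `|b x|^s = |x|^s` for `|b| = 1`. [folklore] -/
theorem ideleNorm_mul_cpow_of_norm_one {b : ideleGroup K} (hb : IdeleClassGroup.ideleNorm K b = 1)
    (s : ℂ) (x : ideleGroup K) :
    ((IdeleClassGroup.ideleNorm K (b * x) : ℝ) : ℂ) ^ s = ((IdeleClassGroup.ideleNorm K x : ℝ) : ℂ) ^ s := by
  rw [map_mul, hb, one_mul]

/-! ### Lemma B on a fundamental domain -/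

variable [MeasurableSpace (ideleGroup K)] [BorelSpace (ideleGroup K)]

/-- **Tate's Lemma B on a fundamental domain (abstract form).** Let `ν` be a left-invariant measure on
`𝕀_K`, `𝓕` a fundamental domain for `Kˣ`, `S ⊆ 𝕀_K` a measurable set stable under multiplication by
the norm-one ideles, `f : 𝕀_K → ℂ` a weight invariant under the norm-one ideles, and `η` a Hecke
character with `η(b) ≠ 1` for some idele `b` of norm one. Then `∫_{S ∩ 𝓕} f(x) η(x) dν(x) = 0`:
`F = 𝟙_S f η` is `Kˣ`-invariant, so `∫_𝓕 F = ∫_{b𝓕} F` (independence of the fundamental domain), and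
`∫_{b𝓕} F = ∫_𝓕 F(b x) dν = η(b) ∫_𝓕 F` (left invariance), whence `(1 - η(b)) ∫_𝓕 F = 0`. This is
"`∫_E c(t𝔟) d𝔟 = 0` if `c(𝔞)` is non trivial on `J`" (Tate, proof of Thm. 4.4.1, Lemma B), for the
layers `S` of the norm. [cite: CasselsFrohlichANT1967, Ch. XV Thm. 4.4.1 (proof, Lemma B)] -/
theorem setIntegral_mul_heckeCharacter_eq_zero_of_norm_one (ν : Measure (ideleGroup K)) [ν.IsMulLeftInvariant]
    {𝓕 : Set (ideleGroup K)} (h𝓕 : IsFundamentalDomain (principalIdeles K) 𝓕 ν)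
    {S : Set (ideleGroup K)} (hS : MeasurableSet S)
    (hSb : ∀ b : ideleGroup K, IdeleClassGroup.ideleNorm K b = 1 → ∀ x, b * x ∈ S ↔ x ∈ S)
    {f : ideleGroup K → ℂ} (hfb : ∀ b : ideleGroup K, IdeleClassGroup.ideleNorm K b = 1 → ∀ x, f (b * x) = f x)
    {η : HeckeCharacter K} (hη : ∃ b : ideleGroup K, IdeleClassGroup.ideleNorm K b = 1 ∧ η b ≠ 1) :
    ∫ x in S ∩ 𝓕, f x * ((η x : ℂˣ) : ℂ) ∂ν = 0 := by
  haveI : MeasurableMul (ideleGroup K) := by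
    haveI := secondCountableTopology_ideleGroup K
    infer_instance
  haveI : SMulCommClass (ideleGroup K) (principalIdeles K) (ideleGroup K) :=
    ⟨fun g k x => by simp only [Subgroup.smul_def, smul_eq_mul, mul_left_comm]⟩
  obtain ⟨b, hb1, hbη⟩ := hη
  set F : ideleGroup K → ℂ := S.indicator fun x => f x * ((η x : ℂˣ) : ℂ) with hF
  have hk1 : ∀ k : principalIdeles K, IdeleClassGroup.ideleNorm K (k : ideleGroup K) = 1 := fun k =>
    ideleNorm_principal k.2
  -- `F` is `Kˣ`-invariant
  have hFinv : ∀ (k : principalIdeles K) (x : ideleGroup K), F (k • x) = F x := by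
    intro k x
    rw [Subgroup.smul_def, smul_eq_mul]
    by_cases hx : x ∈ S
    · have hkx : (k : ideleGroup K) * x ∈ S := (hSb _ (hk1 k) x).2 hx
      simp only [hF, Set.indicator_of_mem hkx, Set.indicator_of_mem hx]
      rw [hfb _ (hk1 k), map_mul, Units.val_mul, η.map_principal k.2, Units.val_one, one_mul]
    · have hkx : (k : ideleGroup K) * x ∉ S := fun h => hx ((hSb _ (hk1 k) x).1 h)
      simp only [hF, Set.indicator_of_notMem hkx, Set.indicator_of_notMem hx]
  -- `F(b x) = η(b) F(x)`
  have hFb : ∀ x, F (b * x) = ((η b : ℂˣ) : ℂ) * F x := by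
    intro x
    by_cases hx : x ∈ S
    · simp only [hF, Set.indicator_of_mem ((hSb b hb1 x).2 hx), Set.indicator_of_mem hx]
      rw [hfb b hb1, map_mul, Units.val_mul]
      ring
    · simp only [hF, Set.indicator_of_notMem (fun h => hx ((hSb b hb1 x).1 h)), Set.indicator_of_notMem hx,
        mul_zero]
  -- `∫_𝓕 F = ∫_{b𝓕} F = ∫_𝓕 F(b ·) = η(b) ∫_𝓕 F`
  have hfd : IsFundamentalDomain (principalIdeles K) (b • 𝓕) ν := h𝓕.smul_of_comm b
  have h1 : ∫ x in 𝓕, F x ∂ν = ∫ x in b • 𝓕, F x ∂ν := h𝓕.setIntegral_eq hfd hFinv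
  have hpre : (fun x : ideleGroup K => b * x) ⁻¹' (b • 𝓕) = 𝓕 := by
    ext x
    rw [Set.mem_preimage, Set.mem_smul_set_iff_inv_smul_mem, smul_eq_mul, inv_mul_cancel_left]
  have h2 : ∫ x in b • 𝓕, F x ∂ν = ∫ x in 𝓕, F (b * x) ∂ν := by
    have h := (measurePreserving_mul_left ν b).setIntegral_preimage_emb
      (MeasurableEquiv.mulLeft b).measurableEmbedding F (b • 𝓕)
    rw [hpre] at h
    exact h.symm
  have h3 : ∫ x in 𝓕, F (b * x) ∂ν = ((η b : ℂˣ) : ℂ) * ∫ x in 𝓕, F x ∂ν := by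
    simp_rw [hFb]
    exact integral_const_mul _ _
  have hI : (1 - ((η b : ℂˣ) : ℂ)) * ∫ x in 𝓕, F x ∂ν = 0 := by
    rw [sub_mul, one_mul, ← h3, ← h2, ← h1, sub_self]
  have hne : (1 - ((η b : ℂˣ) : ℂ)) ≠ 0 :=
    sub_ne_zero.2 fun h => hbη (Units.val_eq_one.1 h.symm)
  have hint : ∫ x in 𝓕, F x ∂ν = 0 := (mul_eq_zero.1 hI).resolve_left hne
  rw [hF, setIntegral_indicator hS, Set.inter_comm] at hint
  exact hint

/-! ### The twisted Tate formulas -/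

/-- **Twisted Tate formula below the unit norm**: `∫_{𝓕 ∩ {|x| ≤ 1}} |x|^{s} η(x) dν(x) = 0` for every
`s ∈ ℂ`, every left-invariant `ν`, every fundamental domain `𝓕` of `Kˣ` and every Hecke character `η`
non-trivial on the norm-one ideles — the vanishing of Tate's boundary term "`∫₀¹ (∫_E c(t𝔟) d𝔟) …`"
(proof of Thm. 4.4.1: Lemma B, case "`c` non trivial on `J`").
[cite: CasselsFrohlichANT1967, Ch. XV Thm. 4.4.1 (proof, Lemma B)] -/
theorem setIntegral_ideleNorm_cpow_mul_heckeCharacter_eq_zero_of_le_one (ν : Measure (ideleGroup K))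
    [ν.IsMulLeftInvariant] {𝓕 : Set (ideleGroup K)} (h𝓕 : IsFundamentalDomain (principalIdeles K) 𝓕 ν)
    {η : HeckeCharacter K} (hη : ∃ b : ideleGroup K, IdeleClassGroup.ideleNorm K b = 1 ∧ η b ≠ 1) (s : ℂ) :
    ∫ x in {x : ideleGroup K | (IdeleClassGroup.ideleNorm K x : ℝ) ≤ 1} ∩ 𝓕,
      ((IdeleClassGroup.ideleNorm K x : ℝ) : ℂ) ^ s * ((η x : ℂˣ) : ℂ) ∂ν = 0 := by
  refine setIntegral_mul_heckeCharacter_eq_zero_of_norm_one ν h𝓕 ?_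
    (fun b hb x => mul_mem_setOf_ideleNorm_iff hb (fun r => r ≤ 1) x)
    (fun b hb x => ideleNorm_mul_cpow_of_norm_one hb s x) hη
  rw [setOf_ideleNorm_le_one_eq]
  exact measurableSet_logNorm_preimage measurableSet_Iic

/-- **Twisted Tate formula above the unit norm**: `∫_{𝓕 ∩ {|x| ≥ 1}} |x|^{s} η(x) dν(x) = 0` for every
`s ∈ ℂ` and every Hecke character `η` non-trivial on the norm-one ideles (the reflected boundary term).
[cite: CasselsFrohlichANT1967, Ch. XV Thm. 4.4.1 (proof, Lemma B)] -/
theorem setIntegral_ideleNorm_cpow_mul_heckeCharacter_eq_zero_of_one_le (ν : Measure (ideleGroup K))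
    [ν.IsMulLeftInvariant] {𝓕 : Set (ideleGroup K)} (h𝓕 : IsFundamentalDomain (principalIdeles K) 𝓕 ν)
    {η : HeckeCharacter K} (hη : ∃ b : ideleGroup K, IdeleClassGroup.ideleNorm K b = 1 ∧ η b ≠ 1) (s : ℂ) :
    ∫ x in {x : ideleGroup K | 1 ≤ (IdeleClassGroup.ideleNorm K x : ℝ)} ∩ 𝓕,
      ((IdeleClassGroup.ideleNorm K x : ℝ) : ℂ) ^ s * ((η x : ℂˣ) : ℂ) ∂ν = 0 := by
  refine setIntegral_mul_heckeCharacter_eq_zero_of_norm_one ν h𝓕 ?_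
    (fun b hb x => mul_mem_setOf_ideleNorm_iff hb (fun r => 1 ≤ r) x)
    (fun b hb x => ideleNorm_mul_cpow_of_norm_one hb s x) hη
  rw [setOf_one_le_ideleNorm_eq]
  exact measurableSet_logNorm_preimage measurableSet_Ici

/-- **Lemma B on the whole fundamental domain**: `∫_𝓕 |x|^{s} η(x) dν(x) = 0` for every `s ∈ ℂ` and
every Hecke character `η` non-trivial on the norm-one ideles ("`∫_E c(t𝔟) d𝔟 = 0`", all layers at
once). [cite: CasselsFrohlichANT1967, Ch. XV Thm. 4.4.1 (proof, Lemma B)] -/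
theorem setIntegral_ideleNorm_cpow_mul_heckeCharacter_eq_zero (ν : Measure (ideleGroup K))
    [ν.IsMulLeftInvariant] {𝓕 : Set (ideleGroup K)} (h𝓕 : IsFundamentalDomain (principalIdeles K) 𝓕 ν)
    {η : HeckeCharacter K} (hη : ∃ b : ideleGroup K, IdeleClassGroup.ideleNorm K b = 1 ∧ η b ≠ 1) (s : ℂ) :
    ∫ x in 𝓕, ((IdeleClassGroup.ideleNorm K x : ℝ) : ℂ) ^ s * ((η x : ℂˣ) : ℂ) ∂ν = 0 := by
  have h := setIntegral_mul_heckeCharacter_eq_zero_of_norm_one ν h𝓕 MeasurableSet.univ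
    (fun b _ x => by simp) (f := fun x => ((IdeleClassGroup.ideleNorm K x : ℝ) : ℂ) ^ s)
    (fun b hb x => ideleNorm_mul_cpow_of_norm_one hb s x) hη
  rwa [Set.univ_inter] at h

end Literature.NumberTheory.Automorphic
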